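/-
Copyright (c) 2026. All rights reserved.
Released under Apache 2.0 license as described in the file LICENSE.
Authors: abc-iut cell, statement-typer seat abc-iut-L4-t9 (wave 2, block W2-B2).
-/
import Literature.AnabelianGeometry.AbsoluteAnabelian.AbsTopIII.BiAnabelianIncompatibility

/-!
# [AbsTopIII] Corollary 3.7 (ii) and (iv), second half: the diagonal telecore `𝔗_δ`, the family
# `ℋ_δ` on `𝒟*`, `𝒟*` as a core, and the telecore incompatibility; Cor 3.7 (ii)–(iv) assembled

S. Mochizuki, *Topics in absolute anabelian geometry III: global reconstruction algorithms*,
J. Math. Sci. Univ. Tokyo 22 (2015) 939–1156 [MochizukiAbsTopIII2015]; locators = pages of the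
author's manuscript (`paper:url-5493eb38cbb7`; journal pagination not held), read on the page:
Cor 3.7 (ii) pp. 87–88, (iv) p. 88; the proof it refers to, Cor 3.6 (ii)/(iv) pp. 80–82.

Input `𝔖 : BiAnabelianSetting X E N`, the diagram `𝒟*` (`starDiagram`), `𝒟†_{≤1}`, the core
observable `refCoreObs` of (i) (`BiAnabelianDiagrams.lean`), and the bi-anabelian lift datum
`θ : FiberSquare.BiAnabelianLift 𝔖.gal` with its `θ_𝒳` (`MonoAnabelianComparisonMLF.lean`, where
the first two sentences of (ii) — `δ_𝒳` is an equivalence with quasi-inverse `π_𝒳`, `θ_𝒳` — are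
PROVED). Shapes pinned, families quantified, homotopies on generators pinned (style of
abc-iut-L4-t5's Cor 3.6 (ii)/(iv)); object equalities inside pinning clauses hold by `rfl`
(`deltaPinned_objEqs`).

* (ii) `TelecoreDeltaStmt θ`: "`δ_𝒳` gives rise to a telecore structure `𝔗_δ` on `𝒟†_{≤1}` [...] by
  appending to `𝒟‡_{≤1}` telecore edges [...] given by copies of `δ_𝒳`" — a `Telecore` (t2, Def 3.5
  (iv)) over the core `(𝒟‡_{≤1}, 𝒳)` of (i) with the PRINTED edges and functors (`IsTelecoreDelta`:
  one edge `δ_⋎` per `⋎`, functor `δ_𝒳`) and a contact structure containing the homotopies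
  `θ_⋎ : 𝒟_{[γ¹_⋎]} ⥲ 𝒟_{[γ⁰_⋎]}` "arising from `θ_𝒳`" (`ContactPinned`) ["hence, in particular, by
  restriction, a contact structure on the telecore `𝔗_δ`"]; `DeltaFamilyStmt θ`: "the collection
  `{θ_{□⋎}, θ_{□⋎}⁻¹, θ_⋎, θ_⋎⁻¹}_{⋎ ∈ L}` [...] generate a family of homotopies `ℋ_δ` on `𝒟*`"
  (generators `DeltaGen`, pinned by `DeltaPinned`: `θ_{□⋎}` = the identity `δ_□ = pr_⋎ ∘ δ_⋎`,
  `θ_⋎` = `θ_𝒳`); `StarGaloisCoreStmt`: "`𝒟* = 𝒟*_{≤4}` admits a natural structure of core on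
  `𝒟*_{≤3}`" (shape pinned: the edge `𝒩 → 𝔈`). NOT typed: "in a fashion compatible with the core
  structure of `𝒟†_{≤4}` on `𝒟†_{≤3}`" (transport along the inclusion `𝒟† ⊆ 𝒟*`).
* (iv), second sentence, `TelecoreIncompatibleStmt θ`: "the telecore structure `𝔗_δ`, the family of
  homotopies `ℋ_δ`, and the observable `𝔖†_log` are not simultaneously compatible" — typed on `𝒟*`
  (the common diagram containing all three): NO family of homotopies on `𝒟*` contains the pinned
  generators of `ℋ_δ` (`DeltaPinned`), the telecore homotopy used in the proof (p. 82:
  `[δ_⋎] ⇝ [δ_⋎]∘[π_⋎]∘[log_𝒳]∘[δ_{⋎+1}]`, the identity, `TelePinned`) and the `𝔖†_log` homotopies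
  `ι_{log,⋎}`, `ι_×` (`StarLogPinned`). This implies the printed statement (a family witnessing
  Def 3.5 (ii)-compatibility of the three contains these homotopies).
* `Cor_3_7_ii θ`, `Cor_3_7_iii`, `Cor_3_7_iv θ` assemble the items ((i), (v): `BiAnabelianDiagrams`).

All statements are per-setting `Prop`s (FACT-policy). Refereed pre-IUT anabelian geometry; nothing
here bears on [IUTchIII] Cor. 3.12; typed ≠ discharged.
-/

set_option autoImplicit false

namespace Literature.AnabelianGeometry.AbsoluteAnabelian.AbsTopIII

open CategoryTheory Quiver DiagramOfCategories

universe u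

namespace BiAnabelianSetting

variable {X E N : Type u} [Category.{u} X] [Category.{u} E] [Category.{u} N]
  (𝔖 : BiAnabelianSetting X E N)

/-! ## Paths on `Γ⃗_{𝒟*}` named in Cor 3.7 (ii) and in the proof of (iv) -/

section StarPaths

/-- `[γ¹_⋎]`: "the path on `Γ⃗_{𝒟*}` of length 2 that starts from `⋎`, descends via `π_⋎` to the core
vertex, and returns to `⋎` via the telecore edge `δ_⋎`" (`[γ⁰_⋎]` is `Path.nil`).
[cite: MochizukiAbsTopIII2015, Cor 3.7 (ii) pp.87–88] -/
def gammaOne (n : ℤ) : Path (Cor37Vertex.first n) (Cor37Vertex.first n) :=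
  ((Path.nil : Path (Cor37Vertex.first n) (.first n)).cons
    (Cor37Edge.proj.{u} n : Cor37Vertex.first n ⟶ .ref)).cons (Cor37Edge.diag.{u} n)

/-- The arrow `δ_□ : 𝒳 → 𝒳` as a path from the core vertex to `□`.
[cite: MochizukiAbsTopIII2015, Cor 3.7 (ii) p.87] -/
def deltaBoxPath : Path Cor37Vertex.ref Cor37Vertex.box :=
  (Path.nil : Path Cor37Vertex.ref .ref).cons (Cor37Edge.diagBox.{u} : Cor37Vertex.ref ⟶ .box)

/-- The composite arrow `pr_⋎ ∘ δ_⋎ : 𝒳 → 𝒳` as a path from the core vertex to `□`.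
[cite: MochizukiAbsTopIII2015, Cor 3.7 (ii) p.88] -/
def prDeltaPath (n : ℤ) : Path Cor37Vertex.ref Cor37Vertex.box :=
  ((Path.nil : Path Cor37Vertex.ref .ref).cons
    (Cor37Edge.diag.{u} n : Cor37Vertex.ref ⟶ .first n)).cons (Cor37Edge.pr.{u} n)

/-- `[δ_⋎]` as a path from the core vertex. [cite: MochizukiAbsTopIII2015, Cor 3.7 (ii) p.87] -/
def deltaPath (n : ℤ) : Path Cor37Vertex.ref (Cor37Vertex.first n) :=
  (Path.nil : Path Cor37Vertex.ref .ref).cons (Cor37Edge.diag.{u} n : Cor37Vertex.ref ⟶ .first n)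

/-- The telecore path `[δ_⋎] ∘ [π_⋎] ∘ [log_𝒳] ∘ [δ_{⋎+1}]` of the proof of the second incompatibility
(p. 82, "`[φ_⋎] ⇝ [β¹_⋎] ∘ [log] ∘ [φ_{⋎+1}]`" read for `𝒟*`). [cite: MochizukiAbsTopIII2015, Cor 3.7 (iv) p.88] -/
def telePath (n : ℤ) : Path Cor37Vertex.ref (Cor37Vertex.first n) :=
  ((((Path.nil : Path Cor37Vertex.ref .ref).cons
    (Cor37Edge.diag.{u} (n + 1) : Cor37Vertex.ref ⟶ .first (n + 1))).cons
    (Cor37Edge.log.{u} (n + 1) n rfl)).cons (Cor37Edge.proj.{u} n)).cons (Cor37Edge.diag.{u} n)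

/-- The type-(1) pair of `𝔖†_log` seen in `𝒟*`, left path `[λ^×]∘[pr_⋎]∘[log_𝒳]`.
[cite: MochizukiAbsTopIII2015, Cor 3.7 (iii) p.88] -/
def starLogLeft (n : ℤ) : Path (Cor37Vertex.first (n + 1)) Cor37Vertex.space :=
  (((Path.nil : Path (Cor37Vertex.first (n + 1)) (.first (n + 1))).cons
    (Cor37Edge.log.{u} (n + 1) n rfl : Cor37Vertex.first (n + 1) ⟶ .first n)).cons
    (Cor37Edge.pr.{u} n)).cons Cor37Edge.lamTimes.{u}

/-- The type-(1) pair of `𝔖†_log` seen in `𝒟*`, right path `[λ^{×pf}]∘[pr_{⋎+1}]`.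
[cite: MochizukiAbsTopIII2015, Cor 3.7 (iii) p.88] -/
def starLogRight (n : ℤ) : Path (Cor37Vertex.first (n + 1)) Cor37Vertex.space :=
  ((Path.nil : Path (Cor37Vertex.first (n + 1)) (.first (n + 1))).cons
    (Cor37Edge.pr.{u} (n + 1) : Cor37Vertex.first (n + 1) ⟶ .box)).cons Cor37Edge.lamTimesPf.{u}

/-- The type-(2) pair of `𝔖†_log` seen in `𝒟*`: `[λ^×]` and `[λ^{×pf}]` from `□`.
[cite: MochizukiAbsTopIII2015, Cor 3.7 (iii) p.88] -/
def starTimes (b : Bool) : Path Cor37Vertex.box Cor37Vertex.space :=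
  (Path.nil : Path Cor37Vertex.box .box).cons
    (if b then (Cor37Edge.lamTimes.{u} : Cor37Vertex.box ⟶ .space) else Cor37Edge.lamTimesPf.{u})

end StarPaths

/-! ## Cor 3.7 (ii): the family `ℋ_δ` on `𝒟*` -/

/-- The GENERATORS of `ℋ_δ`: "`{θ_{□⋎}, θ_{□⋎}⁻¹, θ_⋎, θ_⋎⁻¹}_{⋎ ∈ L}`" — the pairs `([δ_□], [pr_⋎]∘[δ_⋎])`,
`([γ¹_⋎], [γ⁰_⋎])` and their swaps. [cite: MochizukiAbsTopIII2015, Cor 3.7 (ii) p.88] -/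
inductive DeltaGen : ∀ ⦃a b : Cor37Vertex⦄, Path a b → Path a b → Prop
  | boxFwd (n : ℤ) : DeltaGen deltaBoxPath.{u} (prDeltaPath.{u} n)
  | boxBwd (n : ℤ) : DeltaGen (prDeltaPath.{u} n) deltaBoxPath.{u}
  | thetaFwd (n : ℤ) : DeltaGen (gammaOne.{u} n) Path.nil
  | thetaBwd (n : ℤ) : DeltaGen Path.nil (gammaOne.{u} n)

/-- A family of homotopies on `𝒟*` CONTAINS the generators of `ℋ_δ` with the printed homotopies:
"`θ_{□⋎}` the identity natural transformation from the arrow `δ_□ : 𝒳 → 𝒳` to the composite arrow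
`pr_⋎ ∘ δ_⋎ : 𝒳 → 𝒳`" and "`θ_⋎ : 𝒟*_{[γ¹_⋎]} ⥲ 𝒟*_{[γ⁰_⋎]}` the isomorphism arising from `θ_𝒳`".
[cite: MochizukiAbsTopIII2015, Cor 3.7 (ii) p.88] -/
def DeltaPinned (θ : FiberSquare.BiAnabelianLift 𝔖.gal) (H : 𝔖.starDiagram.HomotopyFamily) : Prop :=
  (∀ n : ℤ, ∃ h : H.E deltaBoxPath.{u} (prDeltaPath.{u} n),
    ∀ (x : X) (e : (𝔖.starDiagram.pathFunctor deltaBoxPath.{u}).obj x =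
      (𝔖.starDiagram.pathFunctor (prDeltaPath.{u} n)).obj x), (H.η h).app x = eqToHom e) ∧
  ∀ n : ℤ, ∃ h : H.E (gammaOne.{u} n) Path.nil,
    ∀ (o : 𝔖.Sq) (e₁ : (𝔖.starDiagram.pathFunctor (gammaOne.{u} n)).obj o = (𝔖.proj ⋙ 𝔖.diag).obj o)
      (e₂ : (𝔖.starDiagram.pathFunctor (Path.nil : Path (Cor37Vertex.first n) _)).obj o = o),
      (H.η h).app o = eqToHom e₁ ≫ θ.thetaX.hom.app o ≫ eqToHom e₂.symm

/-- The object equalities quantified in `DeltaPinned`, `TelePinned`, `StarLogPinned` hold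
(non-vacuity of their `∀ e` clauses). [cite: MochizukiAbsTopIII2015, Cor 3.7 (ii) p.88] -/
theorem deltaPinned_objEqs (n : ℤ) (x : X) (o : 𝔖.Sq) :
    (𝔖.starDiagram.pathFunctor deltaBoxPath.{u}).obj x =
      (𝔖.starDiagram.pathFunctor (prDeltaPath.{u} n)).obj x ∧
    (𝔖.starDiagram.pathFunctor (gammaOne.{u} n)).obj o = (𝔖.proj ⋙ 𝔖.diag).obj o ∧
    (𝔖.starDiagram.pathFunctor (deltaPath.{u} n)).obj x =
      (𝔖.starDiagram.pathFunctor (telePath.{u} n)).obj x ∧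
    (𝔖.starDiagram.pathFunctor (starLogLeft.{u} n)).obj o = 𝔖.lamTimes.obj (𝔖.log.obj o.fst) ∧
    (𝔖.starDiagram.pathFunctor (starLogRight.{u} n)).obj o = 𝔖.lamTimesPf.obj o.fst := by
  refine ⟨?_, ?_, ?_, ?_, ?_⟩ <;>
    simp only [deltaBoxPath, prDeltaPath, gammaOne, deltaPath, telePath, starLogLeft, starLogRight,
      pathFunctor_cons, pathFunctor_nil, Functor.comp_obj, Functor.id_obj] <;> rfl

/-- **Cor 3.7 (ii)**: "the collection of natural transformations `{θ_{□⋎}, θ_{□⋎}⁻¹, θ_⋎, θ_⋎⁻¹}_{⋎ ∈ L}`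
[...] generate a family of homotopies `ℋ_δ` on `𝒟*`": a family on `𝒟*` generated by `DeltaGen` with
the printed homotopies on the generators. Per-setting `Prop`. [cite: MochizukiAbsTopIII2015, Cor 3.7 (ii) p.88] -/
def DeltaFamilyStmt (θ : FiberSquare.BiAnabelianLift 𝔖.gal) : Prop :=
  ∃ H : 𝔖.starDiagram.HomotopyFamily, HomotopyFamily.IsGeneratedBy _ H DeltaGen.{u} ∧ 𝔖.DeltaPinned θ H

/-! ## Cor 3.7 (ii): the telecore `𝔗_δ` on `𝒟†_{≤1}` over the core `(𝒟‡_{≤1}, 𝒳)` -/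

section Telecore

variable {𝔖}
variable {H : ((𝔖.daggerLe 1).extend 𝔖.refCoreExt).HomotopyFamily}
  {hH : ∀ ⦃a b : refCoreShape.{u}.Vertex⦄ ⦃p q : Path a b⦄, H.E p q → b = refCoreShape.{u}.obs}
  {hc : (𝔖.refCoreObs H hH).IsCore}

/-- The diagram of categories underlying a telecore over the core `(𝒟‡_{≤1}, 𝒳)` (it is `𝒟‡_δ` when
the telecore has the printed shape). [cite: MochizukiAbsTopIII2015, Cor 3.7 (ii) p.87] -/
abbrev teleDiagram (T : (𝔖.daggerLe 1).Telecore (𝔖.refCoreObs H hH) hc) :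
    DiagramOfCategories (ExtShape.Vertex ⟨refCoreShape.{u}.I, T.J⟩) :=
  (𝔖.daggerLe 1).extend (X := ⟨(𝔖.refCoreObs H hH).shape.I, T.J⟩)
    ⟨(𝔖.refCoreObs H hH).ext.S, (𝔖.refCoreObs H hH).ext.obsMap, T.telMap⟩

/-- The vertex `⋎ = n` of the telecore's graph. [cite: MochizukiAbsTopIII2015, Cor 3.7 (ii) p.87] -/
def tv (T : (𝔖.daggerLe 1).Telecore (𝔖.refCoreObs H hH) hc) (n : ℤ) :
    ExtShape.Vertex ⟨refCoreShape.{u}.I, T.J⟩ :=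
  ExtShape.base _ (dv 1 (.first n) (Cor37Vertex.first_inDaggerLe n le_rfl))

/-- The telecore `𝔗_δ` has the PRINTED shape: exactly one telecore edge `δ_⋎` from the core vertex to
each `⋎ ∈ L`, carrying the functor `δ_𝒳`. [cite: MochizukiAbsTopIII2015, Cor 3.7 (ii) p.87] -/
structure IsTelecoreDelta (T : (𝔖.daggerLe 1).Telecore (𝔖.refCoreObs H hH) hc) : Prop where
  nonempty_J : ∀ n : ℤ, Nonempty (T.J (dv 1 (.first n) (Cor37Vertex.first_inDaggerLe n le_rfl)))
  subsingleton_J : ∀ a, Subsingleton (T.J a)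
  telMap_eq : ∀ (n : ℤ) (j : T.J (dv 1 (.first n) (Cor37Vertex.first_inDaggerLe n le_rfl))),
    T.telMap j = 𝔖.diag

/-- `[γ¹_⋎]` on the telecore's graph: `⋎ → core → ⋎` via `π_⋎` and the telecore edge `j = δ_⋎`.
[cite: MochizukiAbsTopIII2015, Cor 3.7 (ii) p.88] -/
def teleGammaOne (T : (𝔖.daggerLe 1).Telecore (𝔖.refCoreObs H hH) hc) (n : ℤ)
    (j : T.J (dv 1 (.first n) (Cor37Vertex.first_inDaggerLe n le_rfl))) : Path (tv T n) (tv T n) :=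
  ((Path.nil : Path (tv T n) (tv T n)).cons
    (show tv T n ⟶ ExtShape.obs ⟨refCoreShape.{u}.I, T.J⟩ from PUnit.unit)).cons
    (show ExtShape.obs ⟨refCoreShape.{u}.I, T.J⟩ ⟶ tv T n from j)

/-- A family on the telecore's diagram CONTAINS the homotopies `θ_⋎` "arising from `θ_𝒳`" for the
pairs `([γ¹_⋎], [γ⁰_⋎])` — the restriction of `ℋ_δ` that is "a contact structure on the telecore `𝔗_δ`".
[cite: MochizukiAbsTopIII2015, Cor 3.7 (ii) p.88] -/
def ContactPinned (θ : FiberSquare.BiAnabelianLift 𝔖.gal)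
    (T : (𝔖.daggerLe 1).Telecore (𝔖.refCoreObs H hH) hc) (Hc : (teleDiagram T).HomotopyFamily) :
    Prop :=
  ∀ (n : ℤ) (j : T.J (dv 1 (.first n) (Cor37Vertex.first_inDaggerLe n le_rfl))),
    ∃ h : Hc.E (teleGammaOne T n j) Path.nil,
      ∀ (o : 𝔖.Sq)
        (e₁ : ((teleDiagram T).pathFunctor (teleGammaOne T n j)).obj o = (𝔖.proj ⋙ 𝔖.diag).obj o)
        (e₂ : ((teleDiagram T).pathFunctor (Path.nil : Path (tv T n) _)).obj o = o),
        (Hc.η h).app o = eqToHom e₁ ≫ θ.thetaX.hom.app o ≫ eqToHom e₂.symm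

/-- For a telecore of the printed shape the object equality in `ContactPinned` holds
(non-vacuity). [cite: MochizukiAbsTopIII2015, Cor 3.7 (ii) p.88] -/
theorem contactPinned_objEq {T : (𝔖.daggerLe 1).Telecore (𝔖.refCoreObs H hH) hc}
    (hT : IsTelecoreDelta T) (n : ℤ)
    (j : T.J (dv 1 (.first n) (Cor37Vertex.first_inDaggerLe n le_rfl))) (o : 𝔖.Sq) :
    ((teleDiagram T).pathFunctor (teleGammaOne T n j)).obj o = (𝔖.proj ⋙ 𝔖.diag).obj o := by
  simp only [teleGammaOne, pathFunctor_cons, pathFunctor_nil, Functor.comp_obj, Functor.id_obj]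
  show (T.telMap j).obj (𝔖.proj.obj o) = _
  rw [hT.telMap_eq]

end Telecore

/-- **Cor 3.7 (ii)**: "`δ_𝒳` gives rise to a telecore structure `𝔗_δ` on `𝒟†_{≤1}` [...] by appending to
`𝒟‡_{≤1}` telecore edges [...] from the core `𝒳` to the various copies of `𝒳 ×_𝔈 𝒳` in `𝒟†_{≤1}` given
by copies of `δ_𝒳`", and `{θ_⋎^{±1}}` give "[by restriction] a contact structure on the telecore `𝔗_δ`":
over SOME core structure of (i) on `(𝒟‡_{≤1}, 𝒳)`, a telecore of the printed shape with a contact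
structure containing the `θ_⋎`. Per-setting `Prop`. [cite: MochizukiAbsTopIII2015, Cor 3.7 (ii) p.87] -/
def TelecoreDeltaStmt (θ : FiberSquare.BiAnabelianLift 𝔖.gal) : Prop :=
  ∃ (H : ((𝔖.daggerLe 1).extend 𝔖.refCoreExt).HomotopyFamily)
    (hH : ∀ ⦃a b : refCoreShape.{u}.Vertex⦄ ⦃p q : Path a b⦄, H.E p q → b = refCoreShape.{u}.obs)
    (hc : (𝔖.refCoreObs H hH).IsCore) (T : (𝔖.daggerLe 1).Telecore (𝔖.refCoreObs H hH) hc),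
    IsTelecoreDelta T ∧ ∃ Hc : (teleDiagram T).HomotopyFamily,
      Telecore.IsContactStructure (𝔖.daggerLe 1) T Hc ∧ ContactPinned θ T Hc

/-! ## Cor 3.7 (ii), last sentence: `𝒟*` is a core on `𝒟*_{≤3}` -/

/-- Observation-edge shape "`𝒟*` on `𝒟*_{≤3}`": the single edge `𝒩 → 𝔈`.
[cite: MochizukiAbsTopIII2015, Cor 3.7 (ii) p.88] -/
def starGalCoreI : SubVertex {a : Cor37Vertex | a.row ≤ 3} → Type u
  | ⟨.space, _⟩ => PUnit
  | ⟨.first _, _⟩ => PEmpty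
  | ⟨.box, _⟩ => PEmpty
  | ⟨.galois, _⟩ => PEmpty
  | ⟨.ref, _⟩ => PEmpty

/-- The shape `𝒟*_{≤3} ∪ {𝔈}`. [cite: MochizukiAbsTopIII2015, Cor 3.7 (ii) p.88] -/
def starGalCoreShape : ExtShape.{u} (SubVertex {a : Cor37Vertex | a.row ≤ 3}) where
  I := starGalCoreI.{u}
  J _ := PEmpty

/-- Extension data: `𝔈` at the observation vertex, `𝒩 → 𝔈` on the edge.
[cite: MochizukiAbsTopIII2015, Cor 3.7 (ii) p.88] -/
def starGalCoreExt : (𝔖.starLe 3).ExtData starGalCoreShape.{u} where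
  S := E
  obsMap {a} i := match a, i with
    | ⟨.space, _⟩, _ => 𝔖.spaceGal
    | ⟨.first _, _⟩, i => PEmpty.elim i
    | ⟨.box, _⟩, i => PEmpty.elim i
    | ⟨.galois, _⟩, i => PEmpty.elim i
    | ⟨.ref, _⟩, i => PEmpty.elim i
  telMap j := PEmpty.elim j

/-- The observable `(𝒟*, v = 𝔈, ℋ)` on `𝒟*_{≤3}`. [cite: MochizukiAbsTopIII2015, Cor 3.7 (ii) p.88] -/
def starGalCoreObs (H : ((𝔖.starLe 3).extend 𝔖.starGalCoreExt).HomotopyFamily)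
    (hH : ∀ ⦃a b : starGalCoreShape.{u}.Vertex⦄ ⦃p q : Path a b⦄,
      H.E p q → b = starGalCoreShape.{u}.obs) : (𝔖.starLe 3).Observable where
  shape := starGalCoreShape
  isEmpty_J _ := inferInstanceAs (IsEmpty PEmpty)
  ext := 𝔖.starGalCoreExt
  H := H
  terminal_obs := hH

/-- **Cor 3.7 (ii), last sentence**: "`𝒟* = 𝒟*_{≤4}` admits a natural structure of core on `𝒟*_{≤3}`
[...] loosely speaking, `𝔈` 'forms a core' of the functors in `𝒟*`". NOT typed: "in a fashion
compatible with the core structure of `𝒟†_{≤4}` on `𝒟†_{≤3}`". Per-setting `Prop`.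
[cite: MochizukiAbsTopIII2015, Cor 3.7 (ii) p.88] -/
def StarGaloisCoreStmt : Prop := ∃ H hH, (𝔖.starGalCoreObs H hH).IsCore

/-! ## Cor 3.7 (iv), second incompatibility (on `𝒟*`) -/

/-- A family on `𝒟*` contains the telecore homotopy `[δ_⋎] ⇝ [δ_⋎]∘[π_⋎]∘[log_𝒳]∘[δ_{⋎+1}]` (the core
homotopy — the identity, all path functors into the core vertex being `π` — whiskered by `δ_⋎`).
[cite: MochizukiAbsTopIII2015, Cor 3.7 (iv) p.88] -/
def TelePinned (K : 𝔖.starDiagram.HomotopyFamily) : Prop :=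
  ∀ n : ℤ, ∃ h : K.E (deltaPath.{u} n) (telePath.{u} n),
    ∀ (x : X) (e : (𝔖.starDiagram.pathFunctor (deltaPath.{u} n)).obj x =
      (𝔖.starDiagram.pathFunctor (telePath.{u} n)).obj x), (K.η h).app x = eqToHom e

/-- A family on `𝒟*` contains the `𝔖†_log` homotopies `ι_{log,⋎}` (type (1)) and `ι_×` (type (2)).
[cite: MochizukiAbsTopIII2015, Cor 3.7 (iv) p.88] -/
def StarLogPinned (K : 𝔖.starDiagram.HomotopyFamily) : Prop :=
  (∃ h : K.E (starTimes.{u} true) (starTimes.{u} false),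
    ∀ (x : X) (e₁ : (𝔖.starDiagram.pathFunctor (starTimes.{u} true)).obj x = 𝔖.lamTimes.obj x)
      (e₂ : (𝔖.starDiagram.pathFunctor (starTimes.{u} false)).obj x = 𝔖.lamTimesPf.obj x),
      (K.η h).app x = eqToHom e₁ ≫ 𝔖.iotaTimes.app x ≫ eqToHom e₂.symm) ∧
  ∀ n : ℤ, ∃ h : K.E (starLogLeft.{u} n) (starLogRight.{u} n),
    ∀ (o : 𝔖.Sq)
      (e₁ : (𝔖.starDiagram.pathFunctor (starLogLeft.{u} n)).obj o = 𝔖.lamTimes.obj (𝔖.log.obj o.fst))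
      (e₂ : (𝔖.starDiagram.pathFunctor (starLogRight.{u} n)).obj o = 𝔖.lamTimesPf.obj o.fst),
      (K.η h).app o = eqToHom e₁ ≫ 𝔖.iotaLog.app o.fst ≫ eqToHom e₂.symm

/-- **Cor 3.7 (iv), second sentence**: "the telecore structure `𝔗_δ` of (ii), the family of homotopies
`ℋ_δ` of (ii), and the observable `𝔖†_log` of (iii) are not simultaneously compatible": no family of
homotopies on `𝒟*` contains the pinned `ℋ_δ`-generators, the telecore homotopy and the `𝔖†_log`
homotopies at once (implies print; proof for the MLF setting "entirely similar" to Cor 3.6 (iv),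
p. 82, ending in Lemma 3.4). Per-setting `Prop`. [cite: MochizukiAbsTopIII2015, Cor 3.7 (iv) p.88] -/
def TelecoreIncompatibleStmt (θ : FiberSquare.BiAnabelianLift 𝔖.gal) : Prop :=
  ¬ ∃ K : 𝔖.starDiagram.HomotopyFamily, 𝔖.DeltaPinned θ K ∧ 𝔖.TelePinned K ∧ 𝔖.StarLogPinned K

/-! ## Cor 3.7 (ii)–(iv) assembled -/

/-- **Cor 3.7 (ii)** (the typed part; sentences 1–2 are the PROVED `FiberSquare.BiAnabelianLift.
diagonalEquivalence` / `thetaX`): telecore `𝔗_δ` with its contact structure, the family `ℋ_δ` on `𝒟*`,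
and `𝒟*` a core on `𝒟*_{≤3}`. [cite: MochizukiAbsTopIII2015, Cor 3.7 (ii) pp.87–88] -/
def Cor_3_7_ii (θ : FiberSquare.BiAnabelianLift 𝔖.gal) : Prop :=
  𝔖.TelecoreDeltaStmt θ ∧ 𝔖.DeltaFamilyStmt θ ∧ 𝔖.StarGaloisCoreStmt

/-- **Cor 3.7 (iii)** (= `ObservableLogStmt`). [cite: MochizukiAbsTopIII2015, Cor 3.7 (iii) p.88] -/
def Cor_3_7_iii : Prop := 𝔖.ObservableLogStmt

/-- **Cor 3.7 (iv)**: both incompatibilities. [cite: MochizukiAbsTopIII2015, Cor 3.7 (iv) p.88] -/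
def Cor_3_7_iv (θ : FiberSquare.BiAnabelianLift 𝔖.gal) : Prop :=
  𝔖.IncompatibleStmt ∧ 𝔖.TelecoreIncompatibleStmt θ

end BiAnabelianSetting

end Literature.AnabelianGeometry.AbsoluteAnabelian.AbsTopIII
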